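import Summits.BirchSwinnertonDyer.BirchSwinnertonDyer.Theorems.ErratumRoadFiveNonSurjCornerUpper
import Summits.BirchSwinnertonDyer.Rank1Residual.X11b.BDPRouteOddOnTree
import Summits.BirchSwinnertonDyer.Rank1Residual.X11b.BDPRouteOddPrime
import Summits.BirchSwinnertonDyer.Rank1Residual.X11b.BDPRouteSurj
import HarnessLib

/-!
# Route `ErratumRoadFive` (rung K2a), crux 6 = item 19065 `NonSurjCorner` — the localised
# non-surjective corner (T4′) SPLIT INTO HALVES, file 2/2: the main-conjecture half, image-free chain
# (cell `bsd-stepL`, seat `bsd-stepL-corner-p1` g0; `--supports stmt-BirchSwinnertonDyer-19065`)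

HONEST FRAMING as in file 1/2 (`ErratumRoadFiveNonSurjCornerUpper.lean`): nothing here proves the crux;
nothing is booked; X11b stays CONSTRUCTION-SHAPED. File 1/2 put the corner's Euler-system half in the
cone of cruxes `EulerHalfOffLocus` (19062) + `X11aLowerHalf` (19064) + Matar–Nekovář 2019. This file
types the remaining MAIN-CONJECTURE half `ord_p #Ш(E)_an ≤ ord_p #Ш(E)` on the corner by the route's
own road (Jetchev–Skinner–Wan §7.4.1 at `p ∥ N`), every step image-free:

* §1 the print-shape bookkeeping `Typed.MissingUpperBoundAt ⟹ ord_p #Ш + ord_p ∏c − 2·ord_p #tors ≤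
  ord_p (L(E^d,1)/Ω)` for a rank-`0` twist with irreducible `E^d[p]` (twin of additive-p1's
  `exists_printShape_lower_of_missingLowerBoundAt_rankZero`);
* §2 the class-level chain `missingLowerBoundAt_of_classX11b_of_openInputNoSurj_of_upperTwist`
  (Gross–Zagier-currency variants: file 3, `ErratumRoadFiveNonSurjCornerIndex.lean`): Hoffstein–Luo odd field with
  `d_K < −4`, Manin-unit datum (Mazur 1978 Cor. 4.1), STEP L from an open input of the SHAPE of
  `P2OpenInputOnTreeAt` past its class antecedents (no `Surj`) through the image-free bridge
  `indexLowerBoundAt_of_heegner_of_openInput_prime` (control from (irr) ∧ `p ∥ N`), the twist's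
  `≤`-half from Wuthrich 2014 Prop. 21 when `ρ̄_{E^{d_K},p}` IS onto and from the typed input otherwise;
* §3 **`NonSurjCorner` ⇐ (corner open input: the body of crux `OpenInputIMC` with `5 ≤ p → Surj W p`
  replaced by the corner's localisation) ∧ (Euler-system half of the rank-`0` TWIN corner:
  `ClassX11a Wd p ∧ ¬ Surj Wd p ∧ p ∈ {5,7} ∧ p ∣ ord_p Δ_min(Wd)`) ∧ `EulerHalfOffLocus` ∧
  `X11aLowerHalf` ∧ published facts** — `erratumRoadFive_nonSurjCorner_of_openInputNoSurj_of_twinUpper`.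

Why these two inputs are honest residuals (no source): every printed anticyclotomic divisibility at the
trivial character (Howard 2004 "`Gal(K̄/K) → Aut_{ℤ_p}(T)` surjective", Castella 2018 + erratum (2.4) ⇐
Fouquet–Wan Thm. 4.41, Burungale–Castella–Kim) assumes an image containing `SL₂(𝔽_p)`; on the twin
corner Kato's `Hyp(ℚ, T_pE)` fails (an element `τ` with `T/(τ−1)T ≅ ℤ_p` forces a unipotent of order `p`
in `ρ̄(G_ℚ)`, whose order is prime to `p` there) and Wuthrich 2014 Prop. 21's constant `C` is supported
exactly at primes of non-surjective irreducible image. So the corner's residual is ONE anticyclotomic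
divisibility for `N_s(p)` ∕ `5S4` image plus ONE integral Kato divisibility for the same images in rank
`0` — the K6 object «integral IMC for irreducible non-surjective image» of the programme (README §2),
shared with rows A4/A5/A9, not a corner-specific construction.

References: [MatarNekovar2019] Thm. 0.3, §0.11; [JetchevSkinnerWan2017] §7.4.1–7.4.2 (pp. 30–31);
[Wuthrich2014] Prop. 21 (p. 400); [Castella2018] Thm. 2.3, Thm. 3.2 (shape); [Castella2018Erratum] (2.4);
[Howard2004] Thm. A hypotheses; [Kato2004Asterisque] Thm. 17.4; [Rubin2000EulerSystems] Hyp(K,T) §2.1;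
[HoffsteinLuo1997]; [Mazur1978] Cor. 4.1; [MilneADT2006] I 2.8, I 4.10(b); [Miller2011LMS] Def. 1.1.
-/

noncomputable section

open scoped Classical

open WeierstrassCurve NumberField IsDedekindDomain Field
open Literature.NumberTheory.EllipticCurves Literature.NumberTheory.EllipticCurves.GreenbergSelmer
  Literature.NumberTheory.EllipticCurves.ModularForms
  Literature.NumberTheory.EllipticCurves.Rank1Residual
  Literature.NumberTheory.EllipticCurves.Rank1Residual.Typed
  Literature.NumberTheory.EllipticCurves.Wuthrich2014
  Literature.NumberTheory.EllipticCurves.BalakrishnanEtAl2019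
  Literature.NumberTheory.QuadraticFields.Quadratic
  Literature.NumberTheory.Automorphic
  Literature.NumberTheory.GaloisRepresentations Literature.NumberTheory.GaloisCohomology
  Summit.BirchSwinnertonDyer.Rank1Residual.X11b.AcSelmer
  Summit.BirchSwinnertonDyer.Rank1Residual.X11b.LocBridge

namespace Summit.BirchSwinnertonDyer.Rank1Residual.X11b

/-! ### §1–§2. The main-conjecture half on the corner: image-free chain from a corner open input -/

/-- **From the cell's `MissingUpperBoundAt` to the print shape, rank `0`, `E[p]` irreducible** (the
`≥`-direction twin of additive-p1's `exists_printShape_lower_of_missingLowerBoundAt_rankZero`). For a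
globally minimal `Wd` of analytic rank `0` with `L(Wd,1) ≠ 0` and `Wd[p]` irreducible,
`MissingUpperBoundAt Wd p` (`#Ш_an = q ∈ ℚ`, `ord_p #Ш ≤ ord_p q`) gives `L(Wd,1)/Ω = q' ∈ ℚ` with
`ord_p #Ш + ord_p ∏c_ℓ − 2 ord_p #tors ≤ ord_p q'` (bookkeeping: `L^{(0)}(1)/0! = L(1)`, `Reg = 1`,
`#Ш_an = L(1) #tors²/(Ω ∏c)`, `ord_p #tors = 0` by Mazur under (irr); GZK for `rank = 0`) — the shape
`htw` of multr1-p2's `missingLowerBoundAt_of_indexLowerBoundAt`.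
[cite: Miller2011LMS, §1 and Def. 1.1 (arXiv:1010.2431 p. 3)] -/
theorem exists_printShape_upper_of_missingUpperBoundAt_rankZero (Wd : WeierstrassCurve ℚ)
    [Wd.IsElliptic] [Wd.IsGloballyMinimal] (p : ℕ) [Fact p.Prime]
    (hGZK : rank_eq_analyticRank_of_analyticRank_le_one)
    (hr0 : Wd.analyticRank = 0) (hL1 : Wd.entireLFunction 1 ≠ 0) (hirr : Irr Wd p)
    (hup : Typed.MissingUpperBoundAt Wd p) :
    ∃ q : ℚ, Wd.entireLFunction 1 / (Wd.realPeriodRat : ℂ) = (q : ℂ) ∧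
      (padicValNat p Wd.shaOrder : ℤ) + padicValNat p Wd.tamagawaProduct -
        2 * padicValNat p Wd.torsionOrder ≤ padicValRat p q := by
  obtain ⟨q, hq, hle⟩ := hup
  have hrank : Wd.mordellWeilRank = 0 := by rw [(hGZK Wd (by rw [hr0]; exact zero_le_one)).1, hr0]
  have htors : padicValNat p Wd.torsionOrder = 0 :=
    padicValNat_torsionOrder_eq_zero_of_irreducible Wd p hirr
  have hc : 0 < Wd.tamagawaProduct := Wd.tamagawaProduct_pos_holds
  have ht : 0 < Wd.torsionOrder := Wd.torsionOrder_pos_holds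
  have hΩ : (Wd.realPeriodRat : ℂ) ≠ 0 := by exact_mod_cast Wd.realPeriodRat_pos_holds.ne'
  have htC : (Wd.torsionOrder : ℂ) ≠ 0 := by exact_mod_cast ht.ne'
  have hcC : (Wd.tamagawaProduct : ℂ) ≠ 0 := by exact_mod_cast hc.ne'
  -- `L(1) = #Ш_an · Ω · ∏c / #tors²`
  have hsha := hq
  rw [shaAn_def, Wd.leadingLCoeff_eq_of_analyticRank_eq_zero hr0,
    Wd.regulator_eq_one_of_rank_zero hrank] at hsha
  have hL : Wd.entireLFunction 1 =
      (q : ℂ) * ((Wd.realPeriodRat : ℂ) * (Wd.tamagawaProduct : ℂ)) / (Wd.torsionOrder : ℂ) ^ 2 := by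
    rw [← hsha]
    push_cast
    field_simp
  have hq0 : q ≠ 0 := by
    rintro rfl
    apply hL1
    rw [hL]
    push_cast
    ring
  refine ⟨q * (Wd.tamagawaProduct : ℚ) / (Wd.torsionOrder : ℚ) ^ 2, ?_, ?_⟩
  · rw [hL]
    push_cast
    field_simp
  · have htq : (Wd.torsionOrder : ℚ) ≠ 0 := by exact_mod_cast ht.ne'
    have hcq : (Wd.tamagawaProduct : ℚ) ≠ 0 := by exact_mod_cast hc.ne'
    rw [padicValRat.div (mul_ne_zero hq0 hcq) (pow_ne_zero 2 htq), padicValRat.mul hq0 hcq,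
      padicValRat.pow, padicValRat.of_nat, padicValRat.of_nat, htors]
    simp only [Nat.cast_zero, mul_zero, sub_zero]
    omega

/-- **The main-conjecture half `ord_p #Ш(E)_an ≤ ord_p #Ш(E)` at ONE X11b pair with `p ≥ 5`, ANY
IMAGE, from an open input of the shape of `P2OpenInputOnTreeAt` WITHOUT its antecedent `Surj W p`
(stated inline, `hA`) and the Euler-system half of the non-surjective rank-`0` Heegner twists (`hUtw`).**
Chain: the Hoffstein–Luo field with `d_K` odd, `d_K < −4`, every `ℓ ∣ N` and `p` split, `L(E^{d_K},1) ≠ 0`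
(`exists_admissibleField_of_rootNumber_eq_neg_one`); the Manin-unit datum (`exists_maninDatum_of_odd`:
modularity, Mazur 1978 Cor. 4.1, Néron scaling — a tree theorem); STEP L there from `hA` by the
image-free bridge `indexLowerBoundAt_of_heegner_of_openInput_prime` (control from (irr) ∧ `p ∥ N`,
Poitou–Tate, local Euler characteristic); the twist's `≤`-half from Wuthrich 2014 Prop. 21 when
`ρ̄_{E^{d_K},p}` is onto (`twist_le_half_of_wuthrich`) and from `hUtw` otherwise; Gross–Zagier
bookkeeping (`missingLowerBoundAt_of_indexLowerBoundAt`). On the (T4′) corner `hA` is the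
body of crux `OpenInputIMC` with `Surj ↦ ¬Surj` [NO source: Howard 2004, Castella 2018, Fouquet–Wan 2021
all need an image containing `SL₂`] and `hUtw` the rank-`0` twin corner's Euler-system half [NO source:
Kato's `Hyp(ℚ, T_pE)` fails for an image of order prime to `p`; Wuthrich 2014 Prop. 21's constant `C` is
supported exactly there]. CONDITIONAL on `hA`, `hUtw`; nothing booked.
[cite: Wuthrich2014, Prop. 21 (p. 400)] [cite: JetchevSkinnerWan2017, §7.4.1 (pp. 30–31)]
[cite: Castella2018, Thm. 2.3 (p. 5), Thm. 3.2 (p. 9) (shape)] [cite: HoffsteinLuo1997, Theorem (§1)]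
[cite: Mazur1978, Cor. 4.1] [cite: MilneADT2006, Ch. I, Thm. 4.10(b) and Thm. 2.8] [cite: Miller2011LMS, Def. 1.1] -/
theorem missingLowerBoundAt_of_classX11b_of_openInputNoSurj_of_upperTwist
    (hGZ : ∀ (N : ℕ) [NeZero N] (W : WeierstrassCurve ℚ) (K : Type) [Field K] [NumberField K],
      gross_zagier N W K)
    (hKo : ∀ (N : ℕ) [NeZero N] (W : WeierstrassCurve ℚ) (K : Type) [Field K] [NumberField K],
      kolyvagin N W K)
    (hWu : sha_dvd_analyticSha)
    (hGZK : rank_eq_analyticRank_of_analyticRank_le_one) (hmod : hasEntireLFunction_rat)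
    (hnf : exists_isNewformOf) (hHL : HoffsteinLuo1997_exists_twist_L_one_ne_zero)
    (hMaz : mazur_not_dvd_maninConstant_of_odd)
    (hPT : ∀ (K : Type) [Field K] [NumberField K], poitouTate_sum_localTatePairing_eq_zero K)
    (hEP : ∀ (K : Type) [Field K] [NumberField K] (v : HeightOneSpectrum (𝓞 K)),
      localEulerPoincareCharacteristic (v.adicCompletion K))
    (W : WeierstrassCurve ℚ) [W.IsElliptic] [W.IsGloballyMinimal] (p : ℕ) [Fact p.Prime]
    (hX : ClassX11b W p) (hp5 : 5 ≤ p)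
    -- the open input at this pair (shape of `P2OpenInputOnTreeAt W p` past its class antecedents)
    (hA : ∀ (N : ℕ) [NeZero N] (K : Type) [Field K] [NumberField K]
      (Dt : ModularParametrizationData W N) (H : HeegnerDatum N (NumberField.discr K)) (ι : K →+* ℂ)
      (P : (W.baseChange K).toAffine.Point),
      W.conductorNorm ℤ = N → IsImaginaryQuadratic K →
      Odd (NumberField.discr K) → ¬ (p : ℤ) ∣ NumberField.discr K → ¬ p ∣ Units.torsionOrder K →
      SatisfiesHeegnerHypothesis N K →
      (W.quadraticTwist (NumberField.discr K : ℚ)).entireLFunction 1 ≠ 0 →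
      WeierstrassCurve.Affine.Point.map ι.toRatAlgHom P = heegnerPointComplex Dt H →
      ¬ (p : ℤ) ∣ Dt.c → ¬ IsOfFinAddOrder P →
      ∀ (κ : ZpExtension K p), κ.IsAnticyclotomic →
        ∀ (γ : Field.absoluteGaloisGroup K) [Fact (κ.IsTopGenerator γ)]
          (𝔭 : HeightOneSpectrum (𝓞 K)) (h𝔭 : ((p : ℕ) : 𝓞 K) ∈ 𝔭.asIdeal)
          (he : 𝔭.asIdeal.ramificationIdx (𝓞 ℚ) = 1) (hf : 𝔭.asIdeal.inertiaDeg (𝓞 ℚ) = 1),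
          IMCLowerWaldspurgerOnTreeAt p κ 𝔭 γ (embAt K p 𝔭 h𝔭 he hf) P)
    -- the Euler-system half of the NON-surjective rank-`0` Heegner twists of this pair (typed)
    (hUtw : ∀ (K : Type) [Field K] [NumberField K]
      (Wd : WeierstrassCurve ℚ) [Wd.IsElliptic] [Wd.IsGloballyMinimal] (Cd : VariableChange ℚ),
      IsImaginaryQuadratic K → SatisfiesHeegnerHypothesis (W.conductorNorm ℤ) K →
      (W.quadraticTwist (NumberField.discr K : ℚ)).entireLFunction 1 ≠ 0 →
      Cd • W.quadraticTwist (NumberField.discr K : ℚ) = Wd → ¬ Surj Wd p →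
      Typed.MissingUpperBoundAt Wd p) :
    Typed.MissingLowerBoundAt W p := by
  have hNS : integral_neronScaling_of_isGloballyMinimal :=
    integral_neronScaling_of_isGloballyMinimal_holds
  have hp : p.Prime := Fact.out
  obtain ⟨hr, hp2, hmult, hirr⟩ := hX
  haveI : NeZero (W.conductorNorm ℤ) := ⟨(W.conductorNorm_pos_holds).ne'⟩
  -- the sign of the functional equation is `−1` (modularity, `r_an = 1`)
  have hw : W.rootNumber = -1 := by
    rw [WeierstrassCurve.rootNumber_eq_neg_one_pow_analyticRank_of_exists_isNewformOf hnf W, hr]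
    norm_num
  -- the Hoffstein–Luo field: `d_K` odd, `d_K < −4`, every `ℓ ∣ N` and `p` split, `L(E^{d_K},1) ≠ 0`
  obtain ⟨K, _, _, hK, hodd, hlt, hHN, hHp, hLt⟩ :=
    exists_admissibleField_of_rootNumber_eq_neg_one hnf hHL W hw p
  have hpd : ¬ (p : ℤ) ∣ NumberField.discr K := not_dvd_discr_of_split hK hp hp2 hHp
  have hμ : ¬ p ∣ Units.torsionOrder K := by
    haveI : IsTotallyComplex K := hK.2
    rw [Literature.NumberTheory.DiophantineGeometry.torsionOrder_eq_two_of_discr_lt hK.1 hlt]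
    intro h2
    have := Nat.le_of_dvd two_pos h2
    omega
  -- the Heegner datum with `p ∤ c`
  obtain ⟨Dt, H, ι, P, hP, hc⟩ :=
    exists_maninDatum_of_odd hnf hMaz hNS W p (W.conductorNorm ℤ) K rfl hp2 hmult hirr hK hHN
  have hPinf : ¬ IsOfFinAddOrder P :=
    not_isOfFinAddOrder_of_heegner_of_analyticRank_eq_one W _ K Dt H ι P (hGZ _ W K) hmod hr hK hHN
      hLt hP
  -- a globally minimal model of the twist
  have hD0 : (NumberField.discr K : ℚ) ≠ 0 := by exact_mod_cast NumberField.discr_ne_zero K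
  haveI hEt : (W.quadraticTwist (NumberField.discr K : ℚ)).IsElliptic :=
    W.isElliptic_quadraticTwist hD0
  obtain ⟨Cd, hCd⟩ := hasGlobalMinimalModel_rat_holds (W.quadraticTwist (NumberField.discr K : ℚ))
  haveI : (Cd • W.quadraticTwist (NumberField.discr K : ℚ)).IsGloballyMinimal := hCd
  set Wd : WeierstrassCurve ℚ := Cd • W.quadraticTwist (NumberField.discr K : ℚ) with hWd_def
  have hWd : Cd • W.quadraticTwist (NumberField.discr K : ℚ) = Wd := rfl
  -- STEP L at the datum from the open input (image-free bridge)
  have hL : IndexLowerBoundAt W p K P :=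
    indexLowerBoundAt_of_heegner_of_openInput_prime W p _ K Dt H ι P (hGZ _ W K) hKo hmod hPT hEP
      hr hmult hirr rfl hK hHN hLt hP (hA _ K Dt H ι P rfl hK hodd hpd hμ hHN hLt hP hc hPinf)
  -- transports to the minimal twist model and the twist's rank `0`
  have hmultd : Wd.HasMultiplicativeReductionAtPrime p :=
    hasMultiplicativeReductionAtPrime_twist_of_heegner' W p K hK hHN hmult Cd hWd
  have hirrd : Wd.HasIrreducibleModPGaloisRep p :=
    hasIrreducibleModPGaloisRep_twist_model W p K hK.1 hirr Cd hWd
  have htam : padicValNat p Wd.tamagawaProduct = padicValNat p W.tamagawaProduct :=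
    padicValNat_tamagawaProduct_twist_of_heegner W p hp5 K hK hHN Cd hWd
  have hu : padicValRat p (Cd.u : ℚ) = 0 :=
    padicValRat_u_eq_zero_of_twist_minimal W p K hK hHN hmult Cd hWd
  have hLt' : (W.quadraticTwist (NumberField.discr K : ℚ)).entireLFunction = Wd.entireLFunction := by
    rw [← hWd, entireLFunction_smul]
  have hLd1 : Wd.entireLFunction 1 ≠ 0 := by rw [← hLt']; exact hLt
  have hrd : Wd.analyticRank = 0 := (Wd.analyticRank_eq_zero_iff_holds (hmod Wd)).2 hLd1
  -- the twist's `≤`-half in print shape: Wuthrich 2014 Prop. 21 if `ρ̄_{E^d,p}` is onto, typed otherwise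
  have htw : ∃ q : ℚ, Wd.entireLFunction 1 / (Wd.realPeriodRat : ℂ) = (q : ℂ) ∧
      (padicValNat p Wd.shaOrder : ℤ) + padicValNat p Wd.tamagawaProduct -
        2 * padicValNat p Wd.torsionOrder ≤ padicValRat p q := by
    by_cases hsd : Surj Wd p
    · exact twist_le_half_of_wuthrich hWu hGZK hmod Wd p hp2 hLd1 hmultd hsd
    · exact exists_printShape_upper_of_missingUpperBoundAt_rankZero Wd p hGZK hrd hLd1 hirrd
        (hUtw K Wd Cd hK hHN hLt hWd hsd)
  exact missingLowerBoundAt_of_indexLowerBoundAt W p _ K Dt H ι P (hGZ _ W K) (hKo _ W K) hGZK hmod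
    hK hHN hP hp2 hc hμ hr hLt Wd Cd hWd hu htam htw (fun _ ↦ hL)

end Summit.BirchSwinnertonDyer.Rank1Residual.X11b

/-! ### §3. `NonSurjCorner` from the corner open input and the twin corner's Euler-system half -/

namespace Summit.BirchSwinnertonDyer.Rank1Residual.X11b

open Summit.BirchSwinnertonDyer.BirchSwinnertonDyer.Theses.ErratumRoadFive

/-- **Crux `NonSurjCorner` (item 19065) ⇐ TWO typed residuals + two cruxes of the route + published
facts.** The residuals, both WITHOUT source in print: `hA` — THE open input of route p2 ON THE CORNER,
i.e. the body of crux `OpenInputIMC` (`P2OpenInputOnTreeAt`: the one divisibility of the BDP main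
conjecture at `𝟙` ∘ Castella 2018 Thm. 3.2, `2·(ord_p log_ω P − 1) ≤ ord_p f_ac(0)`, at every odd
Manin-good Heegner datum) with its antecedents `5 ≤ p → Surj W p` replaced by the corner's localisation
`¬ Surj W p → p ∈ {5,7} → p ∣ ord_p Δ_min → ¬ Ram W p`; `hT` — the Euler-system half
`Typed.MissingUpperBoundAt Wd p` on the rank-`0` TWIN corner (`ClassX11a Wd p`, `¬ Surj Wd p`,
`p ∈ {5,7}`, `p ∣ ord_p Δ_min(Wd)`), consumed at the Heegner twists `E^{d_K}` (X11a pairs by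
`classX11a_twist_of_not_ram`; `ord_p Δ_min` is twist-invariant at the split prime `p`,
`padicValInt_minimalDiscriminantInt_twist_eq`). The cruxes BY NAME: `EulerHalfOffLocus` (`h₂`, 19062),
`X11aLowerHalf` (`h₄`, 19064). Published named facts: Gross–Zagier, Kolyvagin, Wuthrich 2014 Prop. 21,
Matar–Nekovář 2019 Thm. 0.3 + §0.11, GZK, modularity ×2, Hoffstein–Luo, Friedberg–Hoffstein (split
field), Mazur 1978 Cor. 4.1, Poitou–Tate, local Euler characteristic. Lower half: file 2 §2; upper
half: file 1. CONDITIONAL on `hA`, `hT`, `h₂`, `h₄`; does NOT close item 19065; nothing booked.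
[cite: Castella2018, Thm. 3.2 (arXiv:1704.06608 p. 9) (shape of hA; nothing asserted)]
[cite: MatarNekovar2019, Thm. 0.3 (p. 456) and §0.11 (p. 457)] [cite: Wuthrich2014, Prop. 21 (p. 400)]
[cite: JetchevSkinnerWan2017, §7.4.1–7.4.2 (pp. 30–31)] [cite: Miller2011LMS, Def. 1.1] -/
theorem erratumRoadFive_nonSurjCorner_of_openInputNoSurj_of_twinUpper
    (hGZ : ∀ (N : ℕ) [NeZero N] (W : WeierstrassCurve ℚ) (K : Type) [Field K] [NumberField K],
      gross_zagier N W K)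
    (hKo : ∀ (N : ℕ) [NeZero N] (W : WeierstrassCurve ℚ) (K : Type) [Field K] [NumberField K],
      kolyvagin N W K)
    (hWu : sha_dvd_analyticSha)
    (hMN : ∀ (N : ℕ) [NeZero N] (W : WeierstrassCurve ℚ) (K : Type) [Field K] [NumberField K],
      MatarNekovar2019.thm03_padicValNat_card_sha_le_of_irreducible N W K)
    (hGZK : rank_eq_analyticRank_of_analyticRank_le_one) (hmod : hasEntireLFunction_rat)
    (hnf : exists_isNewformOf) (hHL : HoffsteinLuo1997_exists_twist_L_one_ne_zero)
    (hFHs : friedbergHoffstein_exists_heegnerField_split_twist_ne_zero)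
    (hMaz : mazur_not_dvd_maninConstant_of_odd)
    (hPT : ∀ (K : Type) [Field K] [NumberField K], poitouTate_sum_localTatePairing_eq_zero K)
    (hEP : ∀ (K : Type) [Field K] [NumberField K] (v : HeightOneSpectrum (𝓞 K)),
      localEulerPoincareCharacteristic (v.adicCompletion K))
    (h₂ : Summit.BirchSwinnertonDyer.BirchSwinnertonDyer.Theses.ErratumRoadFive.EulerHalfOffLocus)
    (h₄ : Summit.BirchSwinnertonDyer.BirchSwinnertonDyer.Theses.ErratumRoadFive.X11aLowerHalf)
    -- residual 1: THE open input of the route ON THE CORNER (`P2OpenInputOnTreeAt` with `¬ Surj`)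
    (hA : ∀ (W : WeierstrassCurve ℚ) [W.IsElliptic] [W.IsGloballyMinimal] (p : ℕ) [Fact p.Prime]
      (N : ℕ) [NeZero N] (K : Type) [Field K] [NumberField K]
      (Dt : ModularParametrizationData W N) (H : HeegnerDatum N (NumberField.discr K)) (ι : K →+* ℂ)
      (P : (W.baseChange K).toAffine.Point),
      ClassX11b W p → ¬ Surj W p → (p = 5 ∨ p = 7) → p ∣ padicValInt p W.minimalDiscriminantInt →
      ¬ Ram W p → W.conductorNorm ℤ = N → IsImaginaryQuadratic K →
      Odd (NumberField.discr K) → ¬ (p : ℤ) ∣ NumberField.discr K → ¬ p ∣ Units.torsionOrder K →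
      SatisfiesHeegnerHypothesis N K →
      (W.quadraticTwist (NumberField.discr K : ℚ)).entireLFunction 1 ≠ 0 →
      WeierstrassCurve.Affine.Point.map ι.toRatAlgHom P = heegnerPointComplex Dt H →
      ¬ (p : ℤ) ∣ Dt.c → ¬ IsOfFinAddOrder P →
      ∀ (κ : ZpExtension K p), κ.IsAnticyclotomic →
        ∀ (γ : Field.absoluteGaloisGroup K) [Fact (κ.IsTopGenerator γ)]
          (𝔭 : HeightOneSpectrum (𝓞 K)) (h𝔭 : ((p : ℕ) : 𝓞 K) ∈ 𝔭.asIdeal)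
          (he : 𝔭.asIdeal.ramificationIdx (𝓞 ℚ) = 1) (hf : 𝔭.asIdeal.inertiaDeg (𝓞 ℚ) = 1),
          IMCLowerWaldspurgerOnTreeAt p κ 𝔭 γ (embAt K p 𝔭 h𝔭 he hf) P)
    -- residual 2: the Euler-system half on the rank-`0` TWIN corner (X11a ∧ ¬Surj, localised)
    (hT : ∀ (Wd : WeierstrassCurve ℚ) [Wd.IsElliptic] [Wd.IsGloballyMinimal] (p : ℕ) [Fact p.Prime],
      ClassX11a Wd p → ¬ Surj Wd p → (p = 5 ∨ p = 7) →
      p ∣ padicValInt p Wd.minimalDiscriminantInt → Typed.MissingUpperBoundAt Wd p) :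
    Summit.BirchSwinnertonDyer.BirchSwinnertonDyer.Theses.ErratumRoadFive.NonSurjCorner := by
  intro W _ _ p _ hX hns h57 hv hnr
  have hp5 : 5 ≤ p := by rcases h57 with h | h <;> omega
  refine Typed.missingPPartAt_of_lower_of_upper W p ?_
    (erratumRoadFive_nonSurjCorner_upperHalf hGZ hKo hMN hGZK hmod hnf hFHs hMaz h₂ h₄ W p hX hns h57
      hv hnr)
  refine missingLowerBoundAt_of_classX11b_of_openInputNoSurj_of_upperTwist hGZ hKo hWu hGZK hmod hnf
    hHL hMaz hPT hEP W p hX hp5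
    (fun N _ K _ _ Dt H ι P hN hK hodd hpd hμ hHN hLt hP hc hPinf ↦
      hA W p N K Dt H ι P hX hns h57 hv hnr hN hK hodd hpd hμ hHN hLt hP hc hPinf) ?_
  intro K _ _ Wd _ _ Cd hK hHN hLt hWd hnsd
  have hD0 : (NumberField.discr K : ℚ) ≠ 0 := by exact_mod_cast NumberField.discr_ne_zero K
  haveI : (W.quadraticTwist (NumberField.discr K : ℚ)).IsElliptic := W.isElliptic_quadraticTwist hD0
  have hrd : Wd.analyticRank = 0 := by
    rw [← hWd, analyticRank_smul]
    exact analyticRank_eq_zero_of_entireLFunction_one_ne_zero _ hLt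
  have hXa : ClassX11a Wd p := classX11a_twist_of_not_ram W p hX hnr K hK hHN Cd hWd hrd
  have hpN : p ∣ W.conductorNorm ℤ := dvd_conductorNorm_of_mult hX.2.2.1
  have hsq := isSquare_discr_padic_of_heegner K hK hHN p hpN
  have hvd : p ∣ padicValInt p Wd.minimalDiscriminantInt := by
    rw [padicValInt_minimalDiscriminantInt_twist_eq W p hD0 hsq Cd hWd]
    exact hv
  exact hT Wd p hXa hnsd h57 hvd

end Summit.BirchSwinnertonDyer.Rank1Residual.X11b

end
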